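import Summits.BirchSwinnertonDyer.BirchSwinnertonDyer.Theorems.PrintCf2RubinValueTwoEllipticUnitsLocalMeasurePrincipal
import Summits.BirchSwinnertonDyer.BirchSwinnertonDyer.Theorems.PrintCf2RubinValueTwoEllipticUnitsLocalMoments
import Summits.BirchSwinnertonDyer.BirchSwinnertonDyer.Theorems.PrintCf2RubinValueTwoEllipticUnitsLocalExistence
import Summits.BirchSwinnertonDyer.BirchSwinnertonDyer.Theorems.PrintCf2RubinValueTwoEllipticUnitsLocalModelPrincipal
import Summits.BirchSwinnertonDyer.BirchSwinnertonDyer.Theorems.PrintCf2RubinValueTwoEllipticUnitsLocalDivisionTwists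
import Summits.BirchSwinnertonDyer.BirchSwinnertonDyer.Theorems.PrintCf2RubinValueTwoEllipticUnitsLocalConjugation
import Summits.BirchSwinnertonDyer.BirchSwinnertonDyer.Theorems.PrintCf2RubinValueTwoEllipticUnitsLocalSeamDegreeOne
import Literature.NumberTheory.GaloisRepresentations.LocalUnramifiedLevelMaxUnramified
import Literature.NumberTheory.GaloisRepresentations.LocalGaloisGroupFrobeniusProofs
import Literature.NumberTheory.GaloisRepresentations.UnramifiedBaseToCompletedIntegers
import Literature.NumberTheory.NumberFields.QuadraticSplitPrimeConjugateTwister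
import HarnessLib

/-!
# de Shalit II.4.12 at one `𝔓` for the elliptic units — EVERY non-print hypothesis DISCHARGED at a principal split prime `v ∣ 2`
# of an imaginary quadratic field (integration certificate of the measure-side chain L9–L15 + the degree-one seam)

Cell `bsd-print-cf2`, width seat `bsd-line-cf2-p1-w2` g23; `--supports` stmt-BirchSwinnertonDyer-24721 (helper, Theses-free). THEOREMS
ONLY; CONDITIONAL on the FOUR published named facts `DeShalit1987.prop24_i_mem_rayClassField`, `prop24_ii_galoisAction`,
`prop24_iii_unit`, `prop25_i_normRelation` (hypotheses, never asserted).

`exists_groupDistribution_twisting_eq_induce_ellipticUnitsLocal_of_principal` (cf2c-w4 g10, `…EllipticUnitsLocalMeasurePrincipal.lean`)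
produces the one-`𝔓` measure `μ` of de Shalit II.4.12 from some thirty pieces of local and global data (`hq h2 u α f E σ₀ ε θ j e₂ ψ`, the
twist family, the two division twists `α₁ α₂`).  Following cf2c-w4 g10's DISCHARGE RECIPE (HANDOFF § «cf2c-w4 g10 — FINAL»), THIS file
SUPPLIES ALL OF THEM BY NAME in the route's case — `K` imaginary quadratic, `2 = v v̄` split, `v = (α₀)` PRINCIPAL (automatic for
`h_K = 1`, e.g. `K = ℚ(√−7)`), `𝔪 ≠ 0, ⊤` stable under `Aut(𝓞_K)` with `w_𝔪 = 1` and `v ∤ 𝔪`: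

* `e₂ := padicIntEquivOfDegreeOne` (-w3 g19) at `e(v|2) = f(v|2) = 1` (`ramificationIdx_eq_one_and_inertiaDeg_eq_one_of_natCast_mem_of_ne`);
  `hq`, `h2` ← `residueFieldCard_adicCompletion_of_padicIntEquiv`, `isUniformizer_natCast_adicCompletion_of_padicIntEquiv` (L11);
* `f, u, α = α₀^f = (u·2)^f` ← `exists_absoluteModel_of_asIdeal_eq_span` (L13); `E := unramifiedLevel K_v f` with `hE`, `hdegE` (L12);
* `σ₀` ← `exists_isAbsArithFrob_holds`; `ε` ← `LubinTate…exists_unit_galAut_eq_mul`; `θ, hθc, hθ1, hθζ, hΘe` ← -w7 g11's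
  `Seam.exists_theta_two_moments_padicEquivOfDegreeOne`; `j := unitBallToUnrCoeff hE` with `hj`, `hjC`; `ψ, hψ` ←
  `SubgroupTower.exists_cellMap_of_character` on `mem_rayAdicTower_iff_inv`;
* the twist family := ALL admissible principal twists `𝔠 = (c)`, `c ≡ 1 mod 𝔪`, `(𝔠, 𝔪v) = 1`, with lifts `g_𝔠 ∈ Gal(K̄/K(𝔪))` of their
  Artin symbols (`exists_forall_absRestrictNormalHom_eq_artinHom_span_singleton`, `mem_ker_of_forall_absRestrictNormalHom_eq_artinHom`) and
  elliptic-unit families `x^𝔠` (`exists_forall_isThetaValueOne'`, L9 — the period lattice `ι(𝔪)` of L7 inside);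
* the division twists `α₁, α₂ = ᾱ₁` ← `exists_divisionTwists` (L14) for `σ := conj|_{𝓞_K}` (L15: `hσσ`, `hnorm`; the conjugate prime
  `σ⁻¹(v) = v̄ ≠ v` by `exists_algEquiv_smul_eq` / `algEquiv_swap_spec`: the automorphism swapping `v, v̄` IS complex conjugation).

* §1 `algEquiv_apply_eq_complexConj` (a non-trivial automorphism of an imaginary quadratic field is complex conjugation),
  ★ `exists_conj_divisionData` (the `σ, v̄`-package of L14's hypotheses at a split prime);
* §2 ★★★ `exists_ellipticUnitsLocalMeasure_of_principal_split` — **∃ (all the data, with every hypothesis of L5/L6/L10 as a conjunct),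
  ∃ μ on `Gal(K̄/K(𝔪))` along `K(𝔪v^{n+1})`, `‖μ‖ = 1`, `δ_{g_𝔠, N𝔠} μ = i(e(𝔠))` levelwise for EVERY admissible principal twist `𝔠`**
  (the conclusion of L10 VERBATIM under the existential telescope; the exposed conjuncts `hθc hθζ hj hq …` are exactly what
  `integral_character_pow_succ_ellipticUnitsLocal` (L6) consumes), and ★★★ `exists_ellipticUnitsLocalMeasure_moments_of_principal_split` —
  the same package WITH THE MOMENTS `∫_G κ^{k+1} dμ = (κ(g_𝔠)^{k+1} − N𝔠)⁻¹ Σ_{c'} κ(r_{c'})^{k+1} [S⁰]D^k H_{r_{c'}⁻¹•e(𝔠)}` (L6's conclusion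
  VERBATIM): the LEFT side of de Shalit's interpolation (17)/(36) at one `𝔓` modulo the four prints only.

HONEST FRAMING: plumbing / integration of accepted kernel theorems (it certifies that the twelve supplier files compose); the four prints stay
hypotheses; the analytic heart (Eisenstein numbers = `L`-values, de Shalit II.4.9–4.10) is NOT here; nothing here closes a crux; no summit
statement is proved; BSD is not proved by any of this.

## References
* [deShalit1987] E. de Shalit, *Iwasawa theory of elliptic curves with complex multiplication* (1987), II.4.12 (p. 66–69), II.4.17 (p. 77–78).
* [NeukirchANT1999] J. Neukirch, *Algebraic Number Theory* (1999), Ch. I §9 (9.1), Ch. VI §7 Thm. (7.1).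
-/

-- the summit namespace `Summit.BirchSwinnertonDyer.BirchSwinnertonDyer` repeats the problem name by design (D-0017)
set_option linter.dupNamespace false
set_option autoImplicit false

noncomputable section

open scoped Classical nonZeroDivisors Pointwise ComplexConjugate NumberField
open Field IsDedekindDomain IsDedekindDomain.HeightOneSpectrum ValuativeRel IsLocalRing MvPowerSeries
open Literature.NumberTheory.NumberFields
open Literature.NumberTheory.GaloisRepresentations Literature.NumberTheory.GaloisRepresentations.IsNonarchimedeanLocalField
  Literature.NumberTheory.GaloisRepresentations.LubinTate Literature.NumberTheory.GaloisRepresentations.ArtinLocalGlobal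
  Literature.NumberTheory.PAdicHodge
open Literature.NumberTheory.EllipticCurves Literature.NumberTheory.EllipticCurves.GroupDistribution
open Literature.NumberTheory.ComplexMultiplication.EllipticUnits
open Literature.NumberTheory.LFunctions.AbelianDensity (artinSymbol)

namespace Summit.BirchSwinnertonDyer.BirchSwinnertonDyer.Theorems.PrintCf2.EllipticUnitsLocal.Discharged

variable {K : Type} [Field K] [NumberField K]

/-! ## §1. The conjugation package at a split prime of an imaginary quadratic field -/

section Conj

open NumberField NumberField.IsCMField

/-- **A non-trivial automorphism of an imaginary quadratic field is complex conjugation** (`Aut(K/ℚ)` has order `2` and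
`conj ≠ 1` on a CM field). [cite: NeukirchANT1999, Ch. I §9 (9.1)] -/
theorem algEquiv_apply_eq_complexConj [NumberField.IsCMField K] (hK2 : Module.finrank ℚ K = 2) {τ : K ≃ₐ[ℚ] K} (hτ : τ ≠ 1)
    (y : K) : τ y = complexConj K y := by
  haveI : Algebra.IsQuadraticExtension ℚ K := ⟨hK2⟩
  let σ : K ≃ₐ[ℚ] K := AlgEquiv.ofRingEquiv (f := (complexConj K).toRingEquiv) (fun q ↦ by
    rw [eq_ratCast, map_ratCast])
  have hσx : ∀ z : K, σ z = complexConj K z := fun _ ↦ rfl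
  have hσ1 : σ ≠ 1 := by
    intro h
    apply complexConj_ne_one K
    ext z
    rw [← hσx, h]; rfl
  have hcard : Nat.card (K ≃ₐ[ℚ] K) = 2 := by rw [IsGalois.card_aut_eq_finrank, hK2]
  obtain ⟨ρ, -, hρ⟩ := (Nat.card_eq_two_iff' (1 : K ≃ₐ[ℚ] K)).mp hcard
  rw [← hσx, (hρ τ hτ).trans (hρ σ hσ1).symm]

/-- ★ **The conjugation package at a split prime**: for `K` imaginary quadratic and two primes `v̄ ≠ v` above the rational prime `p`,
`σ := conj|_{𝓞_K}` is an involution mapping `v̄` into `v`, with `N((a)) = a·σ(a)` in `𝓞_K` — the hypotheses `σ hσσ hσv' hnorm` (with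
`v' := v̄`) of `exists_divisionTwists`. [cite: deShalit1987, II.4.12 (p. 67)] [cite: NeukirchANT1999, Ch. I §9 (9.1), §2 (2.6)] -/
theorem exists_conj_divisionData [NumberField.IsTotallyComplex K] (hK2 : Module.finrank ℚ K = 2) {p : ℕ} (hp : p.Prime)
    {v vbar : HeightOneSpectrum (𝓞 K)} (hv : ((p : ℕ) : 𝓞 K) ∈ v.asIdeal) (hvbar : ((p : ℕ) : 𝓞 K) ∈ vbar.asIdeal) (hne : vbar ≠ v) :
    ∃ σ : 𝓞 K ≃+* 𝓞 K, (∀ a, σ (σ a) = a) ∧ (∀ y ∈ vbar.asIdeal, σ y ∈ v.asIdeal) ∧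
      ∀ a : 𝓞 K, ((Ideal.absNorm (Ideal.span {a}) : ℕ) : 𝓞 K) = a * σ a := by
  haveI : Algebra.IsQuadraticExtension ℚ K := ⟨hK2⟩
  haveI : NumberField.IsCMField K := NumberField.IsCMField.ofCMExtension ℚ K
  refine ⟨NumberField.RingOfIntegers.mapRingEquiv (complexConj K).toRingEquiv, mapRingEquiv_complexConj_apply_apply,
    fun y hy ↦ ?_, natCast_absNorm_span_singleton_eq_mul_conj hK2⟩
  -- the automorphism swapping `v̄` and `v` is complex conjugation
  obtain ⟨τ, hτ⟩ := exists_algEquiv_smul_eq (K := K) hp hv hvbar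
  obtain ⟨hτ1, -, hτswap⟩ := algEquiv_swap_spec hK2 hne hτ
  have h1 : τ • y ∈ v.asIdeal := by
    rw [← hτswap]
    exact Ideal.smul_mem_pointwise_smul_iff.mpr hy
  have h2 : (τ • y : 𝓞 K) = NumberField.RingOfIntegers.mapRingEquiv (complexConj K).toRingEquiv y := by
    apply NumberField.RingOfIntegers.ext
    rw [coe_mapRingEquiv_complexConj, ← algEquiv_apply_eq_complexConj hK2 hτ1]
    rfl
  rwa [h2] at h1

end Conj

/-! ## §2. THE ONE-`𝔓` MEASURE WITH EVERYTHING BUT THE PRINTS DISCHARGED -/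

section Discharged

attribute [local instance] ltNormUniformSpace ltNormIsUniformAddGroup rk1 nF nE fintypeResidueField
attribute [local instance] RelNormCoherentUnits.instCommMonoid

variable [NumberField.IsTotallyComplex K] {𝔪 : Ideal (𝓞 K)} {v vbar : HeightOneSpectrum (𝓞 K)}

set_option maxHeartbeats 1600000 in
/-- ★★★ **de Shalit II.4.12 at one `𝔓` for the elliptic units with EVERY non-print hypothesis discharged.**  Let `K` be imaginary
quadratic, `2 = v v̄` split (`2 ∈ v`, `2 ∈ v̄`, `v̄ ≠ v`) with `v = (α₀)` principal, `𝔪 ≠ 0, ⊤` an `Aut(𝓞_K)`-stable modulus with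
`w_𝔪 = 1` and `v ∤ 𝔪`, and `ι : K → ℂ`.  GIVEN de Shalit II.2.4 (i)/(ii)/(iii) and II.2.5 (i) as named facts, THERE EXIST: the residue /
uniformizer facts `hq h2` at `v`, an absolute Lubin–Tate model `π = u·2`, `α = (u·2)^f ≡ 1 mod 𝔪` generating a `v`-power, the unramified
Galois base `E` of degree `f` with `hE hdegE`, an arithmetic Frobenius `σ₀`, the unit `ε` with `σ₀ε = uε`, a continuous bijective reading
`θ : ℂ_{K_v} → ℂ₂` of norm `≤ 1` on the unit ball hitting all `2`-power roots of unity, the coefficient map `j : 𝒪_E → 𝐃` with `hj hjC`,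
`e₂ : 𝒪_v ≃ ℤ₂` with the compatibility `hΘe`, cell maps `ψ` of `κ_v⁻¹`, and — for EVERY admissible principal twist `𝔠 = (c)`
(`c ≠ 0`, `c ≡ 1 mod 𝔪`, `(𝔠, 𝔪v) = 1`) — a lift `g_𝔠 ∈ Gal(K̄/K(𝔪))` of its Artin symbols on all `K(𝔪v^{m+1})` and the elliptic units
`x^𝔠_m = Θ(1; 𝔪v^{m+1}, 𝔠)`, AND **a bounded distribution `μ` on `Gal(K̄/K(𝔪))` along `K(𝔪v^{n+1})` with `‖μ‖ = 1` and
`δ_{g_𝔠, N𝔠} μ = i(e(𝔠))` levelwise for every such `𝔠`** — the conclusion of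
`exists_groupDistribution_twisting_eq_induce_ellipticUnitsLocal_of_principal` VERBATIM, its division twists `α₁, α₂ = ᾱ₁` supplied by
`exists_divisionTwists` ∘ `exists_conj_divisionData`.  The exposed conjuncts are the hypotheses of `integral_character_pow_succ_ellipticUnitsLocal`.
[cite: deShalit1987, II.4.12 (p. 66–69), II.4.17 (p. 77–78)] [cite: NeukirchANT1999, Ch. VI §7 Thm. (7.1)] -/
theorem exists_ellipticUnitsLocalMeasure_of_principal_split
    (h24i : DeShalit1987.prop24_i_mem_rayClassField) (h24ii : DeShalit1987.prop24_ii_galoisAction)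
    (h24iii : DeShalit1987.prop24_iii_unit) (h25 : DeShalit1987.prop25_i_normRelation)
    (hK : IsImaginaryQuadratic K) (ι : K →+* ℂ)
    (h𝔪0 : 𝔪 ≠ ⊥) (h𝔪1 : 𝔪 ≠ ⊤) (hw : ∀ u : (𝓞 K)ˣ, (u : 𝓞 K) - 1 ∈ 𝔪 → u = 1)
    (h𝔪σ : ∀ (σ : 𝓞 K ≃+* 𝓞 K) (y : 𝓞 K), y ∈ 𝔪 → σ y ∈ 𝔪)
    (hv2 : ((2 : ℕ) : 𝓞 K) ∈ v.asIdeal) (hvbar2 : ((2 : ℕ) : 𝓞 K) ∈ vbar.asIdeal) (hne : vbar ≠ v) (hv : ¬ 𝔪 ≤ v.asIdeal)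
    {α₀ : 𝓞 K} (hv0 : v.asIdeal = Ideal.span {α₀}) :
    ∃ (hq : residueFieldCard (v.adicCompletion K) = 2)
      (h2 : (valuation (v.adicCompletion K)).IsUniformizer ((((2 : ℕ) : 𝒪[v.adicCompletion K]) : v.adicCompletion K)))
      (u : 𝒪[v.adicCompletion K]ˣ)
      (α : 𝓞 K) (hα0 : α ≠ 0) (hα𝔪 : α - 1 ∈ 𝔪) (hαw : ∀ w : HeightOneSpectrum (𝓞 K), w ≠ v → α ∉ w.asIdeal)
      (f : ℕ) (hαπ : ((α : K) : v.adicCompletion K) =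
        ((((u : 𝒪[v.adicCompletion K]) * ((2 : ℕ) : 𝒪[v.adicCompletion K]) : 𝒪[v.adicCompletion K]) : v.adicCompletion K)) ^ f)
      (E : IntermediateField (v.adicCompletion K) (AlgebraicClosure (v.adicCompletion K)))
      (_ : FiniteDimensional (v.adicCompletion K) E) (_ : IsGalois (v.adicCompletion K) E) (hE : E ≤ maxUnramified (v.adicCompletion K))
      (hdegE : ∀ w : WeilGroup (v.adicCompletion K),
        WeilGroup.toAbsGalois (v.adicCompletion K) w ∈ E.fixingSubgroup → (f : ℤ) ∣ WeilGroup.deg w)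
      (σ₀ : absoluteGaloisGroup (v.adicCompletion K)) (hσ₀ : IsAbsArithFrob σ₀)
      (ε : (maxUnramifiedCompletion (v.adicCompletion K))ˣ)
      (hε : maxUnramifiedCompletion.galAut (v.adicCompletion K) σ₀ (ε : maxUnramifiedCompletion (v.adicCompletion K)) =
        algebraMap 𝒪[v.adicCompletion K] (maxUnramifiedCompletion (v.adicCompletion K)) (u : 𝒪[v.adicCompletion K]) *
          (ε : maxUnramifiedCompletion (v.adicCompletion K)))
      (θ : CompletedAlgClosure (v.adicCompletion K) →+* ℂ_[2]) (_ : Continuous θ)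
      (hθ1 : ∀ z : CBall (v.adicCompletion K), ‖θ (z : CompletedAlgClosure (v.adicCompletion K))‖ ≤ 1)
      (_ : ∀ ζ' : ℂ_[2], (∃ n : ℕ, ζ' ^ 2 ^ n = 1) →
        ∃ ζ : CompletedAlgClosure (v.adicCompletion K), (∃ n : ℕ, ζ ^ 2 ^ n = 1) ∧ θ ζ = ζ')
      (j : unitBall E →+* UnrCoeff (v.adicCompletion K))
      (_ : j.comp (algebraMap (LTCoeff (v.adicCompletion K)) (unitBall E)) =
        (intToUnrCoeff (v.adicCompletion K)).comp (LTCoeff.of (v.adicCompletion K)).symm.toRingHom)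
      (hjC : (algebraMap (UnrCoeff (v.adicCompletion K)) (CBall (v.adicCompletion K))).comp j = unitBallToCBall E)
      (e₂ : v.adicCompletionIntegers K ≃+* ℤ_[2])
      (_ : ∀ a : 𝒪[v.adicCompletion K], (θ.comp ((CBall (v.adicCompletion K)).subtype.comp
          (algebraMap (UnrCoeff (v.adicCompletion K)) (CBall (v.adicCompletion K))))) (intToUnrCoeff (v.adicCompletion K) a) =
        padicIntCast ℂ_[2] (((e₂ : v.adicCompletionIntegers K →+* ℤ_[2]).comp
          (integerEquivAdicCompletionIntegers v).toRingHom) a))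
      (ψ : (n : ℕ) → ↥(absRestrictNormalHom (rayClassField K 𝔪)).ker ⧸ (rayAdicTower (𝔪 := 𝔪) h𝔪0 v).U n → ZMod (2 ^ (n + 1)))
      (hψ : ∀ (n : ℕ) (g : ↥(absRestrictNormalHom (rayClassField K 𝔪)).ker), g ∈ (rayAdicTower (𝔪 := 𝔪) h𝔪0 v).U 0 →
        ψ n ((rayAdicTower (𝔪 := 𝔪) h𝔪0 v).proj n g) =
          PadicInt.toZModPow (n + 1) ((((Units.map (e₂ : v.adicCompletionIntegers K →+* ℤ_[2]).toMonoidHom).comp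
            (rayAdicCharacter h𝔪0 hv hw))⁻¹ g : ℤ_[2]ˣ) : ℤ_[2]))
      (g : {c : 𝓞 K // c ≠ 0 ∧ c - 1 ∈ 𝔪 ∧ IsCoprime (Ideal.span {c}) (𝔪 * v.asIdeal)} →
        ↥(absRestrictNormalHom (rayClassField K 𝔪)).ker)
      (_ : ∀ (c : {c : 𝓞 K // c ≠ 0 ∧ c - 1 ∈ 𝔪 ∧ IsCoprime (Ideal.span {c}) (𝔪 * v.asIdeal)}) (m : ℕ),
        absRestrictNormalHom (rayClassField K (𝔪 * v.asIdeal ^ (m + 1))) (g c : absoluteGaloisGroup K) =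
          artinSymbol (galFrob K (rayClassField K (𝔪 * v.asIdeal ^ (m + 1)))) (Ideal.span {c.1}))
      (x : ∀ (_ : {c : 𝓞 K // c ≠ 0 ∧ c - 1 ∈ 𝔪 ∧ IsCoprime (Ideal.span {c}) (𝔪 * v.asIdeal)}) (m : ℕ),
        rayClassField K (𝔪 * v.asIdeal ^ (m + 1)))
      (hx : ∀ (c : {c : 𝓞 K // c ≠ 0 ∧ c - 1 ∈ 𝔪 ∧ IsCoprime (Ideal.span {c}) (𝔪 * v.asIdeal)}) (m : ℕ),
        IsThetaValueOne ι (𝔪 * v.asIdeal ^ (m + 1)) (Ideal.span {c.1})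
          (algClosureEmb ι ((x c m : rayClassField K (𝔪 * v.asIdeal ^ (m + 1))) : AlgebraicClosure K)))
      (_ : ∀ n, ((rayAdicTower (𝔪 := 𝔪) h𝔪0 v).U n).Normal),
    letI := rayAction h𝔪0 hv hw (isUniformizer_unit_mul h2 u) E hE
    ∃ μ : GroupDistribution (rayAdicTower (𝔪 := 𝔪) h𝔪0 v) ℂ_[2], μ.bound = 1 ∧
      ∀ (c : {c : 𝓞 K // c ≠ 0 ∧ c - 1 ∈ 𝔪 ∧ IsCoprime (Ideal.span {c}) (𝔪 * v.asIdeal)}) (n : ℕ)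
        (b : ↥(absRestrictNormalHom (rayClassField K 𝔪)).ker ⧸ (rayAdicTower (𝔪 := 𝔪) h𝔪0 v).U n),
        (twisting (g c) (Ideal.absNorm (Ideal.span {c.1}) : ℂ_[2]) μ).μ n b =
        (GroupDistribution.induce
          (fun β : RelNormCoherentUnits (isUniformizer_unit_mul h2 u) E ↦
            (GroupDistribution.comap (restrictUnits ((invAmice₁ 2 ((PowerSeries.subst (compSeriesC h2 hσ₀ u hε)
              ((relTildeSeries (isUniformizer_unit_mul h2 u) E hq hE hσ₀
                (LTCoeff.of (v.adicCompletion K) (u : 𝒪[v.adicCompletion K])) β).map j)).map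
              (θ.comp ((CBall (v.adicCompletion K)).subtype.comp
                (algebraMap (UnrCoeff (v.adicCompletion K)) (CBall (v.adicCompletion K))))))
              (norm_coeff_relSeries_le_one hq h2 u E hE hσ₀ hε θ hθ1 j hjC β)).density
              (ProfiniteTower.padicInt_isUniform 2) (unitInv ℂ_[2]) uniformContinuous_unitInv norm_unitInv_le))
              ψ ((rayAdicTower (𝔪 := 𝔪) h𝔪0 v).cellMap_trans (((Units.map (e₂ : v.adicCompletionIntegers K →+* ℤ_[2]).toMonoidHom).comp (rayAdicCharacter h𝔪0 hv hw))⁻¹) ψ hψ)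
              ((rayAdicTower (𝔪 := 𝔪) h𝔪0 v).cellMap_injective (((Units.map (e₂ : v.adicCompletionIntegers K →+* ℤ_[2]).toMonoidHom).comp (rayAdicCharacter h𝔪0 hv hw))⁻¹)
                (mem_rayAdicTower_iff_inv h𝔪0 h𝔪0 hv hw e₂ le_rfl hv) ψ hψ)
              ((rayAdicTower (𝔪 := 𝔪) h𝔪0 v).cellMap_fiberSurj (((Units.map (e₂ : v.adicCompletionIntegers K →+* ℤ_[2]).toMonoidHom).comp (rayAdicCharacter h𝔪0 hv hw))⁻¹)
                (mem_rayAdicTower_iff_inv h𝔪0 h𝔪0 hv hw e₂ le_rfl hv)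
                (exists_toZModPow_padicRayAdicCharacter_inv_eq h𝔪0 h𝔪0 hv hw e₂ le_rfl hv) ψ hψ)))
          zero_le_one (fun _ ↦ le_rfl)
          (ellipticUnitsLocal h24iii h25 hK ι h𝔪0 h𝔪1 hv hw (isUniformizer_unit_mul h2 u) hα0 hα𝔪 hαw hαπ E hE hdegE
            (mt Ideal.span_singleton_eq_bot.mp c.2.1) c.2.2.2 (x c) (hx c))).μ n b := by
  -- (0) the frame: `[K : ℚ] = 2`, `e(v|2) = f(v|2) = 1`
  have hK2 : Module.finrank ℚ K = 2 := hK.1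
  haveI := liesOver_ratPlace_of_natCast_mem K v (p := 2) hv2
  obtain ⟨he, hf⟩ := ramificationIdx_eq_one_and_inertiaDeg_eq_one_of_natCast_mem_of_ne K hK2 (p := 2) hv2 hvbar2 hne
  -- (1) `e₂ : 𝒪_v ≃ ℤ₂`, `hq`, `h2`
  set e₂ : v.adicCompletionIntegers K ≃+* ℤ_[2] := padicIntEquivOfDegreeOne K 2 v he hf with he₂
  have hq : residueFieldCard (v.adicCompletion K) = 2 := residueFieldCard_adicCompletion_of_padicIntEquiv (v := v) e₂
  have h2 : (valuation (v.adicCompletion K)).IsUniformizer ((((2 : ℕ) : 𝒪[v.adicCompletion K]) : v.adicCompletion K)) :=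
    isUniformizer_natCast_adicCompletion_of_padicIntEquiv (v := v) e₂
  -- (2) the absolute Lubin–Tate model at the principal `v = (α₀)`: `f`, `u`, `α = α₀^f`
  obtain ⟨f, u, hf0, hα0, hα𝔪, hαw, hαπ⟩ := exists_absoluteModel_of_asIdeal_eq_span h𝔪0 hv e₂ hv0
  -- (3) the unramified Galois base `E := K_v(ζ_{2^f − 1})`
  obtain ⟨hfd, hab, -⟩ := LocalWeilDatum.unramifiedLevel_finite_abelian_unramified (v.adicCompletion K) hf0
  haveI := hfd
  haveI := hab
  have hE : LocalWeilDatum.unramifiedLevel (v.adicCompletion K) f ≤ maxUnramified (v.adicCompletion K) :=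
    unramifiedLevel_le_maxUnramified _ hf0
  have hdegE : ∀ w : WeilGroup (v.adicCompletion K), WeilGroup.toAbsGalois (v.adicCompletion K) w ∈
      (LocalWeilDatum.unramifiedLevel (v.adicCompletion K) f).fixingSubgroup → (f : ℤ) ∣ WeilGroup.deg w :=
    fun w hw' ↦ dvd_deg_of_toAbsGalois_mem_fixingSubgroup_unramifiedLevel _ hf0 w hw'
  -- (4) the local analytic data: `σ₀`, `ε`, `θ`, `j`
  obtain ⟨σ₀, hσ₀⟩ := exists_isAbsArithFrob_holds (v.adicCompletion K)
  obtain ⟨ε, hε⟩ := exists_unit_galAut_eq_mul hσ₀ u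
  obtain ⟨θ, hθc, -, hθ1, hθζ, hΘe, -, -⟩ := Seam.exists_theta_two_moments_padicEquivOfDegreeOne K v he hf
  -- (5) the cell maps of `κ_v⁻¹`
  obtain ⟨ψ, hψ⟩ := SubgroupTower.exists_cellMap_of_character (rayAdicTower (𝔪 := 𝔪) h𝔪0 v)
    ((Units.map (e₂ : v.adicCompletionIntegers K →+* ℤ_[2]).toMonoidHom).comp (rayAdicCharacter h𝔪0 hv hw))⁻¹
    (mem_rayAdicTower_iff_inv h𝔪0 h𝔪0 hv hw e₂ le_rfl hv)
  -- (6) the twist family: all admissible principal twists, their Galois lifts and elliptic units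
  have hcv : ∀ c : {c : 𝓞 K // c ≠ 0 ∧ c - 1 ∈ 𝔪 ∧ IsCoprime (Ideal.span {c}) (𝔪 * v.asIdeal)}, c.1 ∉ v.asIdeal :=
    fun c ↦ not_mem_of_isCoprime_mul c.2.2.2 rfl
  have hG : ∀ c : {c : 𝓞 K // c ≠ 0 ∧ c - 1 ∈ 𝔪 ∧ IsCoprime (Ideal.span {c}) (𝔪 * v.asIdeal)},
      ∃ σ : absoluteGaloisGroup K, σ ∈ (absRestrictNormalHom (rayClassField K 𝔪)).ker ∧
        ∀ m : ℕ, absRestrictNormalHom (rayClassField K (𝔪 * v.asIdeal ^ (m + 1))) σ =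
          artinSymbol (galFrob K (rayClassField K (𝔪 * v.asIdeal ^ (m + 1)))) (Ideal.span {c.1}) := by
    intro c
    obtain ⟨σ, hσ⟩ := exists_forall_absRestrictNormalHom_eq_artinHom_span_singleton h𝔪0 hv c.2.1 c.2.2.1 (hcv c)
    exact ⟨σ, mem_ker_of_forall_absRestrictNormalHom_eq_artinHom h𝔪0 hv c.2.1 c.2.2.1 (hcv c) hσ,
      fun m ↦ by rw [hσ (m + 1), artinHom_toPrincipalIdeal_coe _ c.2.1]⟩
  choose gσ hgker hg using hG
  have hX : ∀ c : {c : 𝓞 K // c ≠ 0 ∧ c - 1 ∈ 𝔪 ∧ IsCoprime (Ideal.span {c}) (𝔪 * v.asIdeal)},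
      ∃ x : ∀ m : ℕ, rayClassField K (𝔪 * v.asIdeal ^ (m + 1)),
        ∀ m, IsThetaValueOne ι (𝔪 * v.asIdeal ^ (m + 1)) (Ideal.span {c.1})
          (algClosureEmb ι ((x m : rayClassField K (𝔪 * v.asIdeal ^ (m + 1))) : AlgebraicClosure K)) :=
    fun c ↦ exists_forall_isThetaValueOne' h24i hK ι h𝔪0 v (mt Ideal.span_singleton_eq_bot.mp c.2.1) c.2.2.2
  choose x hx using hX
  -- (7) the division twists `α₁`, `α₂ = ᾱ₁`
  obtain ⟨σ, hσσ, hσv', hnorm⟩ := exists_conj_divisionData (K := K) hK2 Nat.prime_two hv2 hvbar2 hne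
  obtain ⟨α₁, α₂, hα₁0, hα₂0, hα₁𝔪, hα₂𝔪, hα₁c, hα₂c, hs₁, hs₁', hs₂, hne12, hN1, h4, hN12⟩ :=
    exists_divisionTwists hv hw e₂ σ hσσ (h𝔪σ σ) hne hσv' hnorm
  haveI hN : ∀ n, ((rayAdicTower (𝔪 := 𝔪) h𝔪0 v).U n).Normal := fun n ↦ rayAdicTower_U_normal h𝔪0 v n
  -- (8) assemble
  refine ⟨hq, h2, u, α₀ ^ f, hα0, hα𝔪, hαw, f, hαπ, LocalWeilDatum.unramifiedLevel (v.adicCompletion K) f, hfd, inferInstance, hE, hdegE,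
    σ₀, hσ₀, ε, hε, θ, hθc, hθ1, hθζ, unitBallToUnrCoeff hE, unitBallToUnrCoeff_comp_algebraMap hE,
    algebraMap_comp_unitBallToUnrCoeff hE, e₂, hΘe, ψ, hψ, fun c ↦ ⟨gσ c, hgker c⟩, hg, x, hx, hN, ?_⟩
  exact exists_groupDistribution_twisting_eq_induce_ellipticUnitsLocal_of_principal h24ii h24iii h25 hK ι h𝔪0 h𝔪1 hv hw hq h2 u
    hα0 hα𝔪 hαw hαπ (LocalWeilDatum.unramifiedLevel (v.adicCompletion K) f) hE hdegE hσ₀ hε θ hθ1 (unitBallToUnrCoeff hE)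
    (unitBallToUnrCoeff_comp_algebraMap hE) (algebraMap_comp_unitBallToUnrCoeff hE) e₂ hΘe ψ hψ
    (fun c : {c : 𝓞 K // c ≠ 0 ∧ c - 1 ∈ 𝔪 ∧ IsCoprime (Ideal.span {c}) (𝔪 * v.asIdeal)} ↦ Ideal.span {c.1})
    (fun c ↦ mt Ideal.span_singleton_eq_bot.mp c.2.1) (fun c ↦ c.2.2.2) (fun c ↦ ⟨gσ c, hgker c⟩) hg x hx
    (s := 1) le_rfl ⟨α₁, hα₁0, hα₁𝔪, hα₁c⟩ ⟨α₂, hα₂0, hα₂𝔪, hα₂c⟩ rfl rfl hα₁𝔪 hα₂𝔪 hs₁ hs₁' hs₂ hne12 hN1 h4 hN12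

set_option maxHeartbeats 1600000 in
/-- ★★★ **The same package WITH THE MOMENTS** (de Shalit II.4.12 (29)–(31) with II.4.7 (16)–(17)): under the frame of
`exists_ellipticUnitsLocalMeasure_of_principal_split`, the discharged data and the measure `μ` satisfy, for every admissible principal
twist `𝔠 = (c)` and every `k` with `κ(g_𝔠)^{k+1} ≠ N𝔠` in `ℂ₂`:
**`∫_G κ^{k+1} dμ = (κ(g_𝔠)^{k+1} − N𝔠)⁻¹ · Σ_{c' ∈ G/U_0} κ(r_{c'})^{k+1} · [S⁰] D^k H_{r_{c'}⁻¹ • e(𝔠)}`** (`κ = κ_v⁻¹` in `ℤ₂`) — the conclusion of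
`integral_character_pow_succ_ellipticUnitsLocal` (cf2c-w4 g10, L6) VERBATIM for the discharged data: the LEFT side of de Shalit's (17)/(36)
at one `𝔓` modulo the four prints ONLY (the right side, Eisenstein numbers = `L`-values, II.4.9–4.10, is not here).
[cite: deShalit1987, II.4.12 (29)–(31) (p. 67–69), II.4.7 (16)–(17) (p. 60), I.3.5 (11) (p. 18)] -/
theorem exists_ellipticUnitsLocalMeasure_moments_of_principal_split
    (h24i : DeShalit1987.prop24_i_mem_rayClassField) (h24ii : DeShalit1987.prop24_ii_galoisAction)
    (h24iii : DeShalit1987.prop24_iii_unit) (h25 : DeShalit1987.prop25_i_normRelation)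
    (hK : IsImaginaryQuadratic K) (ι : K →+* ℂ)
    (h𝔪0 : 𝔪 ≠ ⊥) (h𝔪1 : 𝔪 ≠ ⊤) (hw : ∀ u : (𝓞 K)ˣ, (u : 𝓞 K) - 1 ∈ 𝔪 → u = 1)
    (h𝔪σ : ∀ (σ : 𝓞 K ≃+* 𝓞 K) (y : 𝓞 K), y ∈ 𝔪 → σ y ∈ 𝔪)
    (hv2 : ((2 : ℕ) : 𝓞 K) ∈ v.asIdeal) (hvbar2 : ((2 : ℕ) : 𝓞 K) ∈ vbar.asIdeal) (hne : vbar ≠ v) (hv : ¬ 𝔪 ≤ v.asIdeal)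
    {α₀ : 𝓞 K} (hv0 : v.asIdeal = Ideal.span {α₀}) :
    ∃ (hq : residueFieldCard (v.adicCompletion K) = 2)
      (h2 : (valuation (v.adicCompletion K)).IsUniformizer ((((2 : ℕ) : 𝒪[v.adicCompletion K]) : v.adicCompletion K)))
      (u : 𝒪[v.adicCompletion K]ˣ)
      (α : 𝓞 K) (hα0 : α ≠ 0) (hα𝔪 : α - 1 ∈ 𝔪) (hαw : ∀ w : HeightOneSpectrum (𝓞 K), w ≠ v → α ∉ w.asIdeal)
      (f : ℕ) (hαπ : ((α : K) : v.adicCompletion K) =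
        ((((u : 𝒪[v.adicCompletion K]) * ((2 : ℕ) : 𝒪[v.adicCompletion K]) : 𝒪[v.adicCompletion K]) : v.adicCompletion K)) ^ f)
      (E : IntermediateField (v.adicCompletion K) (AlgebraicClosure (v.adicCompletion K)))
      (_ : FiniteDimensional (v.adicCompletion K) E) (_ : IsGalois (v.adicCompletion K) E) (hE : E ≤ maxUnramified (v.adicCompletion K))
      (hdegE : ∀ w : WeilGroup (v.adicCompletion K),
        WeilGroup.toAbsGalois (v.adicCompletion K) w ∈ E.fixingSubgroup → (f : ℤ) ∣ WeilGroup.deg w)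
      (σ₀ : absoluteGaloisGroup (v.adicCompletion K)) (hσ₀ : IsAbsArithFrob σ₀)
      (ε : (maxUnramifiedCompletion (v.adicCompletion K))ˣ)
      (hε : maxUnramifiedCompletion.galAut (v.adicCompletion K) σ₀ (ε : maxUnramifiedCompletion (v.adicCompletion K)) =
        algebraMap 𝒪[v.adicCompletion K] (maxUnramifiedCompletion (v.adicCompletion K)) (u : 𝒪[v.adicCompletion K]) *
          (ε : maxUnramifiedCompletion (v.adicCompletion K)))
      (θ : CompletedAlgClosure (v.adicCompletion K) →+* ℂ_[2]) (_ : Continuous θ)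
      (hθ1 : ∀ z : CBall (v.adicCompletion K), ‖θ (z : CompletedAlgClosure (v.adicCompletion K))‖ ≤ 1)
      (_ : ∀ ζ' : ℂ_[2], (∃ n : ℕ, ζ' ^ 2 ^ n = 1) →
        ∃ ζ : CompletedAlgClosure (v.adicCompletion K), (∃ n : ℕ, ζ ^ 2 ^ n = 1) ∧ θ ζ = ζ')
      (j : unitBall E →+* UnrCoeff (v.adicCompletion K))
      (_ : j.comp (algebraMap (LTCoeff (v.adicCompletion K)) (unitBall E)) =
        (intToUnrCoeff (v.adicCompletion K)).comp (LTCoeff.of (v.adicCompletion K)).symm.toRingHom)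
      (hjC : (algebraMap (UnrCoeff (v.adicCompletion K)) (CBall (v.adicCompletion K))).comp j = unitBallToCBall E)
      (e₂ : v.adicCompletionIntegers K ≃+* ℤ_[2])
      (_ : ∀ a : 𝒪[v.adicCompletion K], (θ.comp ((CBall (v.adicCompletion K)).subtype.comp
          (algebraMap (UnrCoeff (v.adicCompletion K)) (CBall (v.adicCompletion K))))) (intToUnrCoeff (v.adicCompletion K) a) =
        padicIntCast ℂ_[2] (((e₂ : v.adicCompletionIntegers K →+* ℤ_[2]).comp
          (integerEquivAdicCompletionIntegers v).toRingHom) a))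
      (ψ : (n : ℕ) → ↥(absRestrictNormalHom (rayClassField K 𝔪)).ker ⧸ (rayAdicTower (𝔪 := 𝔪) h𝔪0 v).U n → ZMod (2 ^ (n + 1)))
      (hψ : ∀ (n : ℕ) (g : ↥(absRestrictNormalHom (rayClassField K 𝔪)).ker), g ∈ (rayAdicTower (𝔪 := 𝔪) h𝔪0 v).U 0 →
        ψ n ((rayAdicTower (𝔪 := 𝔪) h𝔪0 v).proj n g) =
          PadicInt.toZModPow (n + 1) ((((Units.map (e₂ : v.adicCompletionIntegers K →+* ℤ_[2]).toMonoidHom).comp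
            (rayAdicCharacter h𝔪0 hv hw))⁻¹ g : ℤ_[2]ˣ) : ℤ_[2]))
      (g : {c : 𝓞 K // c ≠ 0 ∧ c - 1 ∈ 𝔪 ∧ IsCoprime (Ideal.span {c}) (𝔪 * v.asIdeal)} →
        ↥(absRestrictNormalHom (rayClassField K 𝔪)).ker)
      (_ : ∀ (c : {c : 𝓞 K // c ≠ 0 ∧ c - 1 ∈ 𝔪 ∧ IsCoprime (Ideal.span {c}) (𝔪 * v.asIdeal)}) (m : ℕ),
        absRestrictNormalHom (rayClassField K (𝔪 * v.asIdeal ^ (m + 1))) (g c : absoluteGaloisGroup K) =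
          artinSymbol (galFrob K (rayClassField K (𝔪 * v.asIdeal ^ (m + 1)))) (Ideal.span {c.1}))
      (x : ∀ (_ : {c : 𝓞 K // c ≠ 0 ∧ c - 1 ∈ 𝔪 ∧ IsCoprime (Ideal.span {c}) (𝔪 * v.asIdeal)}) (m : ℕ),
        rayClassField K (𝔪 * v.asIdeal ^ (m + 1)))
      (hx : ∀ (c : {c : 𝓞 K // c ≠ 0 ∧ c - 1 ∈ 𝔪 ∧ IsCoprime (Ideal.span {c}) (𝔪 * v.asIdeal)}) (m : ℕ),
        IsThetaValueOne ι (𝔪 * v.asIdeal ^ (m + 1)) (Ideal.span {c.1})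
          (algClosureEmb ι ((x c m : rayClassField K (𝔪 * v.asIdeal ^ (m + 1))) : AlgebraicClosure K)))
      (_ : ∀ n, ((rayAdicTower (𝔪 := 𝔪) h𝔪0 v).U n).Normal),
    letI := rayAction h𝔪0 hv hw (isUniformizer_unit_mul h2 u) E hE
    ∃ μ : GroupDistribution (rayAdicTower (𝔪 := 𝔪) h𝔪0 v) ℂ_[2], μ.bound = 1 ∧
      (∀ (c : {c : 𝓞 K // c ≠ 0 ∧ c - 1 ∈ 𝔪 ∧ IsCoprime (Ideal.span {c}) (𝔪 * v.asIdeal)}) (n : ℕ)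
        (b : ↥(absRestrictNormalHom (rayClassField K 𝔪)).ker ⧸ (rayAdicTower (𝔪 := 𝔪) h𝔪0 v).U n),
        (twisting (g c) (Ideal.absNorm (Ideal.span {c.1}) : ℂ_[2]) μ).μ n b =
        (GroupDistribution.induce
          (fun β : RelNormCoherentUnits (isUniformizer_unit_mul h2 u) E ↦
            (GroupDistribution.comap (restrictUnits ((invAmice₁ 2 ((PowerSeries.subst (compSeriesC h2 hσ₀ u hε)
              ((relTildeSeries (isUniformizer_unit_mul h2 u) E hq hE hσ₀
                (LTCoeff.of (v.adicCompletion K) (u : 𝒪[v.adicCompletion K])) β).map j)).map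
              (θ.comp ((CBall (v.adicCompletion K)).subtype.comp
                (algebraMap (UnrCoeff (v.adicCompletion K)) (CBall (v.adicCompletion K))))))
              (norm_coeff_relSeries_le_one hq h2 u E hE hσ₀ hε θ hθ1 j hjC β)).density
              (ProfiniteTower.padicInt_isUniform 2) (unitInv ℂ_[2]) uniformContinuous_unitInv norm_unitInv_le))
              ψ ((rayAdicTower (𝔪 := 𝔪) h𝔪0 v).cellMap_trans (((Units.map (e₂ : v.adicCompletionIntegers K →+* ℤ_[2]).toMonoidHom).comp (rayAdicCharacter h𝔪0 hv hw))⁻¹) ψ hψ)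
              ((rayAdicTower (𝔪 := 𝔪) h𝔪0 v).cellMap_injective (((Units.map (e₂ : v.adicCompletionIntegers K →+* ℤ_[2]).toMonoidHom).comp (rayAdicCharacter h𝔪0 hv hw))⁻¹)
                (mem_rayAdicTower_iff_inv h𝔪0 h𝔪0 hv hw e₂ le_rfl hv) ψ hψ)
              ((rayAdicTower (𝔪 := 𝔪) h𝔪0 v).cellMap_fiberSurj (((Units.map (e₂ : v.adicCompletionIntegers K →+* ℤ_[2]).toMonoidHom).comp (rayAdicCharacter h𝔪0 hv hw))⁻¹)
                (mem_rayAdicTower_iff_inv h𝔪0 h𝔪0 hv hw e₂ le_rfl hv)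
                (exists_toZModPow_padicRayAdicCharacter_inv_eq h𝔪0 h𝔪0 hv hw e₂ le_rfl hv) ψ hψ)))
          zero_le_one (fun _ ↦ le_rfl)
          (ellipticUnitsLocal h24iii h25 hK ι h𝔪0 h𝔪1 hv hw (isUniformizer_unit_mul h2 u) hα0 hα𝔪 hαw hαπ E hE hdegE
    (mt Ideal.span_singleton_eq_bot.mp c.2.1) c.2.2.2 (x c) (hx c))).μ n b) ∧
      ∀ (c : {c : 𝓞 K // c ≠ 0 ∧ c - 1 ∈ 𝔪 ∧ IsCoprime (Ideal.span {c}) (𝔪 * v.asIdeal)}) (k : ℕ),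
        padicIntCast ℂ_[2] (((((Units.map (e₂ : v.adicCompletionIntegers K →+* ℤ_[2]).toMonoidHom).comp (rayAdicCharacter h𝔪0 hv hw))⁻¹) (g c) : ℤ_[2]) ^ (k + 1)) ≠ (Ideal.absNorm (Ideal.span {c.1}) : ℂ_[2]) →
        μ.integral (fun σ ↦ padicIntCast ℂ_[2] (((((Units.map (e₂ : v.adicCompletionIntegers K →+* ℤ_[2]).toMonoidHom).comp (rayAdicCharacter h𝔪0 hv hw))⁻¹) σ : ℤ_[2]) ^ (k + 1))) =
          (padicIntCast ℂ_[2] (((((Units.map (e₂ : v.adicCompletionIntegers K →+* ℤ_[2]).toMonoidHom).comp (rayAdicCharacter h𝔪0 hv hw))⁻¹) (g c) : ℤ_[2]) ^ (k + 1)) - (Ideal.absNorm (Ideal.span {c.1}) : ℂ_[2]))⁻¹ *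
            ∑ c' ∈ (rayAdicTower (𝔪 := 𝔪) h𝔪0 v).cells 0,
              padicIntCast ℂ_[2] (((((Units.map (e₂ : v.adicCompletionIntegers K →+* ℤ_[2]).toMonoidHom).comp (rayAdicCharacter h𝔪0 hv hw))⁻¹) ((rayAdicTower (𝔪 := 𝔪) h𝔪0 v).repr 0 c') : ℤ_[2]) ^ (k + 1)) *
              PowerSeries.constantCoeff (mahlerD^[k] ((PowerSeries.subst (compSeriesC h2 hσ₀ u hε)
                ((relTildeSeries (isUniformizer_unit_mul h2 u) E hq hE hσ₀ (LTCoeff.of (v.adicCompletion K) (u : 𝒪[v.adicCompletion K]))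
                  (((rayAdicTower (𝔪 := 𝔪) h𝔪0 v).repr 0 c')⁻¹ • (ellipticUnitsLocal h24iii h25 hK ι h𝔪0 h𝔪1 hv hw
                    (isUniformizer_unit_mul h2 u) hα0 hα𝔪 hαw hαπ E hE hdegE
                    (mt Ideal.span_singleton_eq_bot.mp c.2.1) c.2.2.2 (x c) (hx c)))).map j)).map
                (θ.comp ((CBall (v.adicCompletion K)).subtype.comp
                  (algebraMap (UnrCoeff (v.adicCompletion K)) (CBall (v.adicCompletion K))))))) := by
  obtain ⟨hq, h2, u, α, hα0, hα𝔪, hαw, f, hαπ, E, hfd, hgal, hE, hdegE, σ₀, hσ₀, ε, hε, θ, hθc, hθ1, hθζ, j, hj, hjC, e₂, hΘe, ψ, hψ,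
    g, hg, x, hx, hN, μ, hμ1, hμ⟩ :=
    exists_ellipticUnitsLocalMeasure_of_principal_split h24i h24ii h24iii h25 hK ι h𝔪0 h𝔪1 hw h𝔪σ hv2 hvbar2 hne hv hv0
  refine ⟨hq, h2, u, α, hα0, hα𝔪, hαw, f, hαπ, E, hfd, hgal, hE, hdegE, σ₀, hσ₀, ε, hε, θ, hθc, hθ1, hθζ, j, hj, hjC, e₂, hΘe, ψ, hψ,
    g, hg, x, hx, hN, μ, hμ1, hμ, fun c k hck ↦ integral_character_pow_succ_ellipticUnitsLocal (h24iii := h24iii) (h25 := h25) (hK := hK) (ι := ι) (h𝔪0 := h𝔪0)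
    (h𝔪1 := h𝔪1) (hv := hv) (hw := hw) (hq := hq) (h2 := h2) (u := u) (hα0 := hα0) (hα𝔪 := hα𝔪) (hαw := hαw) (hαπ := hαπ)
    (E := E) (hE := hE) (hdegE := hdegE) (hσ₀ := hσ₀) (hε := hε) (θ := θ) (hθc := hθc) (hθ1 := hθ1) (hθζ := hθζ) (j := j)
    (hjC := hjC) (e₂ := e₂) (ψ := ψ) (hψ := hψ)
    (idl := fun c : {c : 𝓞 K // c ≠ 0 ∧ c - 1 ∈ 𝔪 ∧ IsCoprime (Ideal.span {c}) (𝔪 * v.asIdeal)} ↦ Ideal.span {c.1})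
    (hidl0 := fun c ↦ mt Ideal.span_singleton_eq_bot.mp c.2.1) (hidlc := fun c ↦ c.2.2.2) (g := g) (x := x) (hx := hx)
    μ hμ c k hck⟩

end Discharged

end Summit.BirchSwinnertonDyer.BirchSwinnertonDyer.Theorems.PrintCf2.EllipticUnitsLocal.Discharged

end
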